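import Mathlib
import HarnessLib
import Literature.Analysis.FluidPDE.LocalTypeI
import Literature.Analysis.FluidPDE.PartialRegularityHolds
import Literature.Analysis.FluidPDE.RusinSverakBackwardRegularityHolds
import Literature.Analysis.FluidPDE.LerayHopfRegularRestartTools
import Literature.Analysis.FluidPDE.SuitableWeakProofs
import Literature.Analysis.FluidPDE.NSBoundedInteriorRegularity

/-!
# Route HardyPointSink — support `ABForwardHardy` (item stmt-NavierStokesRegularity-7983), file 1:
# a clean backward-singular vertex and a continuous representative around it

First helper file for the forward direction of Albritton–Barker 2019, Thm. 1.1 carrying the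
Hardy bound (Seregin–Šverák 2009, §2: "`t₀` is the first singular time of our suitable weak
solution … we can ensure that all conditions of type (b8)–(b10) hold in the parabolic ball
`Q(z₀, r)`").  For a suitable weak solution `(u, p)` of the unforced Navier–Stokes system
(`ν = 1`) in the unit parabolic ball `Q(0, 1)` whose vertex `0` is a backward singular point we
produce a (possibly different) backward singular point `z₀` and a radius `η > 0` with
`Q(z₀, η) ⊆ Q(0, 1)` such that **every point of the open cylinder `Q(z₀, η)` is regular**
(`exists_clean_vertex`): either the vertex itself qualifies, or interior singular points
accumulate at it, and then a singular point of minimal time in a compact box whose bottom and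
lateral edges avoid the singular set (the singular set is `𝒫¹`-null by the tree's
Caffarelli–Kohn–Nirenberg theorem `ckn_partial_regularity_holds`, so its images under the time
coordinate and under `w ↦ ‖w.2‖` are Lebesgue-null, `volume_image_eq_zero_of_isParabolicNull`)
is backward singular by the tree's backward-regularity theorem
`isRegularPoint_of_eLpNorm_parabolicCylinder_lt_top_holds` (Robinson–Rodrigo–Sadowski 2016,
Cor. 15.6).  On the regular cylinder `u` has a continuous representative
(`exists_continuousOn_representative`, from the tree's
`exists_box_continuousOn_ae_eq_of_isRegularPoint`).

## References

* D. Albritton, T. Barker, J. Math. Fluid Mech. 21 (2019) = arXiv:1811.00502, Prop. 2.4, §3.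
* G. Seregin, V. Šverák, Comm. PDE 34 (2009) = arXiv:0804.1803, §2 (p. 6), Thm. 2.8.
* L. Caffarelli, R. Kohn, L. Nirenberg, Comm. Pure Appl. Math. 35 (1982), Theorem B.
-/

noncomputable section

open MeasureTheory Set Function Filter Metric TopologicalSpace
open scoped ENNReal NNReal Topology
open Literature.Analysis.FluidPDE

-- single-problem summit: the namespace repeats the summit name by design (CONVENTIONS §1)
set_option linter.dupNamespace false

namespace Summit.NavierStokesRegularity.NavierStokesRegularity.Theorems.HardyPointSinkABForwardHardy

local notation "E³" => EuclideanSpace ℝ (Fin 3)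

/-! ### Null images of `𝒫¹`-null sets -/

/-- A `𝒫¹`-null set has, for every `ε > 0`, a countable cover by centred parabolic cylinders of
radii `< 1` with `∑ rᵢ < ε` (unfolding of the Caffarelli–Kohn–Nirenberg content at `δ = 1`). -/
theorem exists_cover_of_isParabolicNull {X : Set (ℝ × E³)} (hX : IsParabolicNull 1 X)
    {ε : ℝ≥0∞} (hε : 0 < ε) :
    ∃ (z : ℕ → ℝ × E³) (r : ℕ → ℝ), (∀ i, 0 ≤ r i ∧ r i < 1) ∧
      X ⊆ ⋃ i, parabolicCylinderCentered (r i) (z i) ∧ ∑' i, ENNReal.ofReal (r i) < ε := by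
  have h1 : parabolicHausdorffContent 1 1 X = 0 := by
    refine le_antisymm ?_ bot_le
    calc parabolicHausdorffContent 1 1 X ≤ parabolicHausdorff 1 X :=
          le_iSup₂ (f := fun δ (_ : (0 : ℝ) < δ) => parabolicHausdorffContent 1 δ X) 1 one_pos
      _ = 0 := hX
  have h2 : parabolicHausdorffContent 1 1 X < ε := h1 ▸ hε
  unfold parabolicHausdorffContent at h2
  simp only [iInf_lt_iff] at h2
  obtain ⟨z, r, hr, hcov, hsum⟩ := h2
  refine ⟨z, r, hr, hcov, ?_⟩
  simpa [Real.rpow_one] using hsum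

/-- **Images of `𝒫¹`-null sets under parabolically Lipschitz real functions are Lebesgue-null**:
if `f` moves by at most `r` on every centred cylinder `Q*_r(z)`, `r < 1`, then `f '' X` is
Lebesgue-null for every `𝒫¹`-null `X` (cover `X` by cylinders with `∑ rᵢ < ε/2`; the image is
covered by intervals of total length `< ε`). -/
theorem volume_image_eq_zero_of_isParabolicNull {X : Set (ℝ × E³)} (hX : IsParabolicNull 1 X)
    {f : ℝ × E³ → ℝ}
    (hf : ∀ (z w : ℝ × E³) (r : ℝ), 0 ≤ r → r < 1 → w ∈ parabolicCylinderCentered r z →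
      |f w - f z| ≤ r) :
    volume (f '' X) = 0 := by
  refine le_antisymm (ENNReal.le_of_forall_pos_le_add fun ε hε _ => ?_) bot_le
  rw [zero_add]
  have hε2 : (0 : ℝ≥0∞) < (ε : ℝ≥0∞) / 2 := ENNReal.half_pos (by exact_mod_cast hε.ne')
  obtain ⟨z, r, hr, hcov, hsum⟩ := exists_cover_of_isParabolicNull hX hε2
  have hsub : f '' X ⊆ ⋃ i, Icc (f (z i) - r i) (f (z i) + r i) := by
    rintro _ ⟨w, hw, rfl⟩
    obtain ⟨i, hi⟩ := mem_iUnion.1 (hcov hw)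
    have h := hf (z i) w (r i) (hr i).1 (hr i).2 hi
    rw [abs_le] at h
    exact mem_iUnion.2 ⟨i, ⟨by linarith [h.1], by linarith [h.2]⟩⟩
  calc volume (f '' X) ≤ volume (⋃ i, Icc (f (z i) - r i) (f (z i) + r i)) := measure_mono hsub
    _ ≤ ∑' i, volume (Icc (f (z i) - r i) (f (z i) + r i)) := measure_iUnion_le _
    _ = ∑' i, 2 * ENNReal.ofReal (r i) := by
        refine tsum_congr fun i => ?_
        rw [Real.volume_Icc, show f (z i) + r i - (f (z i) - r i) = 2 * r i by ring,
          ENNReal.ofReal_mul (by norm_num), ENNReal.ofReal_ofNat]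
    _ = 2 * ∑' i, ENNReal.ofReal (r i) := ENNReal.tsum_mul_left
    _ ≤ 2 * ((ε : ℝ≥0∞) / 2) := by gcongr
    _ = ε := ENNReal.mul_div_cancel (by norm_num) (by norm_num)

/-- The time coordinate moves by at most `r² ≤ r` on `Q*_r(z)`, `r < 1`. -/
theorem abs_fst_sub_fst_le {z w : ℝ × E³} {r : ℝ} (hr : 0 ≤ r) (hr1 : r < 1)
    (hw : w ∈ parabolicCylinderCentered r z) : |w.1 - z.1| ≤ r := by
  rw [mem_parabolicCylinderCentered] at hw
  have h2 : r ^ 2 ≤ r := by nlinarith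
  rw [abs_le]
  constructor <;> nlinarith [hw.1.1, hw.1.2]

/-- The spatial norm moves by at most `r` on `Q*_r(z)`. -/
theorem abs_norm_snd_sub_le {z w : ℝ × E³} {r : ℝ}
    (hw : w ∈ parabolicCylinderCentered r z) : |‖w.2‖ - ‖z.2‖| ≤ r := by
  rw [mem_parabolicCylinderCentered] at hw
  have h := abs_norm_sub_norm_le w.2 z.2
  rw [← dist_eq_norm] at h
  exact h.trans hw.2.le

/-- A Lebesgue-null set of reals misses a point of every nontrivial open interval. -/
theorem exists_mem_Ioo_not_mem {N : Set ℝ} (hN : volume N = 0) {a b : ℝ} (hab : a < b) :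
    ∃ c ∈ Ioo a b, c ∉ N := by
  by_contra h
  push Not at h
  have h1 : volume (Ioo a b) ≤ volume N := measure_mono fun c hc => h c hc
  rw [hN, Real.volume_Ioo, nonpos_iff_eq_zero, ENNReal.ofReal_eq_zero] at h1
  linarith

/-! ### The clean vertex -/

/-- Backward cylinders with the same vertex are monotone in the radius (no sign needed). -/
theorem parabolicCylinder_mono_radius {r r' : ℝ} (hr : 0 ≤ r) (h : r ≤ r') (z : ℝ × E³) :
    parabolicCylinder r z ⊆ parabolicCylinder r' z := by
  intro w hw
  rw [mem_parabolicCylinder] at hw ⊢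
  have h2 : r ^ 2 ≤ r' ^ 2 := pow_le_pow_left₀ hr h 2
  exact ⟨⟨by linarith [hw.1.1], hw.1.2⟩, hw.2.trans_le h⟩

/-- **Interior singular points of a suitable weak solution are backward singular** (contrapositive
of the tree's backward-regularity theorem `isRegularPoint_of_eLpNorm_parabolicCylinder_lt_top_holds`,
Robinson–Rodrigo–Sadowski 2016, Cor. 15.6): if `z₀ ∈ O` is not a regular point then `u` is
essentially unbounded on every backward cylinder `Q(z₀, ρ)`. -/
theorem isBackwardSingularPoint_of_not_isRegularPoint {O : Opens (ℝ × E³)}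
    {u : ℝ → E³ → E³} {p : ℝ → E³ → ℝ} (hsw : IsSuitableWeakSolutionOn O 1 0 u p)
    {z₀ : ℝ × E³} (hz₀ : z₀ ∈ (O : Set (ℝ × E³))) (hsing : ¬ IsRegularPoint u z₀) :
    IsBackwardSingularPoint u z₀ := by
  -- a backward cylinder inside `O`
  obtain ⟨ρ₀, hρ₀, hsub₀⟩ : ∃ ρ₀ : ℝ, 0 < ρ₀ ∧ parabolicCylinder ρ₀ z₀ ⊆ (O : Set (ℝ × E³)) := by
    obtain ⟨ε, hε, hball⟩ := Metric.isOpen_iff.1 O.isOpen z₀ hz₀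
    refine ⟨min (ε / 2) (1 / 2), lt_min (by linarith) (by norm_num), fun w hw => hball ?_⟩
    rw [mem_parabolicCylinder] at hw
    have hm1 : min (ε / 2) (1 / 2) ≤ ε / 2 := min_le_left _ _
    have hm2 : min (ε / 2) (1 / 2) ≤ 1 / 2 := min_le_right _ _
    have hm0 : 0 < min (ε / 2) (1 / 2) := lt_min (by linarith) (by norm_num)
    have hsq : min (ε / 2) (1 / 2) ^ 2 ≤ min (ε / 2) (1 / 2) := by nlinarith
    rw [mem_ball, Prod.dist_eq, max_lt_iff]
    refine ⟨?_, ?_⟩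
    · rw [Real.dist_eq, abs_lt]
      constructor <;> nlinarith [hw.1.1, hw.1.2]
    · exact hw.2.trans_le (by linarith)
  intro ρ hρ
  by_contra hfin
  have hfin' : eLpNorm (uncurry u) ⊤ (volume.restrict (parabolicCylinder (min ρ ρ₀) z₀)) < ⊤ := by
    refine lt_of_le_of_lt (eLpNorm_mono_measure _ (Measure.restrict_mono ?_ le_rfl))
      (lt_top_iff_ne_top.2 hfin)
    exact parabolicCylinder_mono_radius (le_min hρ.le hρ₀.le) (min_le_left _ _) z₀
  exact hsing (isRegularPoint_of_eLpNorm_parabolicCylinder_lt_top_holds O u p hsw z₀ hz₀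
    (min ρ ρ₀) (lt_min hρ hρ₀)
    ((parabolicCylinder_mono_radius (le_min hρ.le hρ₀.le) (min_le_right _ _) z₀).trans hsub₀)
    hfin')

/-- **A clean backward-singular vertex** (Seregin–Šverák 2009, §2, first singular time; here
through Caffarelli–Kohn–Nirenberg's `𝒫¹(S) = 0` and the backward-regularity theorem of the
tree).  For a suitable weak solution `(u, p)` (`ν = 1`, no force) in the unit parabolic ball
`Q(0, 1)` with a backward singular vertex there are a backward singular point `z₀` and `η > 0`
with `Q(z₀, η) ⊆ Q(0, 1)` all of whose points are regular points of `u`. -/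
theorem exists_clean_vertex {u : ℝ → E³ → E³} {p : ℝ → E³ → ℝ}
    (hsw : IsSuitableWeakSolutionOn (parabolicCylinderOpens 1 (0 : ℝ × E³)) 1 0 u p)
    (hsing : IsBackwardSingularPoint u 0) :
    ∃ (z₀ : ℝ × E³) (η : ℝ), 0 < η ∧ parabolicCylinder η z₀ ⊆ parabolicCylinder 1 (0 : ℝ × E³) ∧
      (∀ w ∈ parabolicCylinder η z₀, IsRegularPoint u w) ∧ IsBackwardSingularPoint u z₀ := by
  classical
  by_cases hα : ∃ η ∈ Ioc (0 : ℝ) 1, ∀ w ∈ parabolicCylinder η (0 : ℝ × E³), IsRegularPoint u w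
  · obtain ⟨η, hη, hreg⟩ := hα
    exact ⟨0, η, hη.1, parabolicCylinder_mono_radius hη.1.le hη.2 0, hreg, hsing⟩
  push Not at hα
  -- ## the singular set and its null images
  set O : Opens (ℝ × E³) := parabolicCylinderOpens 1 (0 : ℝ × E³) with hO
  set S : Set (ℝ × E³) := singularSet u (O : Set (ℝ × E³)) with hS
  have hSnull : IsParabolicNull 1 S := ckn_partial_regularity_holds O one_pos hsw (isCKNForceOn_zero O)
  have hRegOpen : IsOpen {w : ℝ × E³ | IsRegularPoint u w} := isOpen_setOf_isRegularPoint_holds u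
  -- a singular point inside `Q(0, 1/2)`
  obtain ⟨ws, hws, hwsS⟩ := hα (1 / 2) ⟨by norm_num, by norm_num⟩
  rw [mem_parabolicCylinder] at hws
  simp only [Prod.fst_zero, Prod.snd_zero, zero_sub] at hws
  obtain ⟨⟨hws1, hws2⟩, hws3⟩ := hws
  have hws3' : ‖ws.2‖ < 1 / 2 := by rwa [dist_zero_right] at hws3
  -- the big box `Icc (-1/2) ts ×ˢ closedBall 0 (3/4) ⊆ O`
  set Kbig : Set (ℝ × E³) := Icc (-1 / 2 : ℝ) ws.1 ×ˢ closedBall (0 : E³) (3 / 4) with hKbig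
  have hKbigc : IsCompact Kbig := isCompact_Icc.prod (isCompact_closedBall _ _)
  have hKbigO : Kbig ⊆ (O : Set (ℝ × E³)) := by
    rintro ⟨t, x⟩ ⟨⟨ht1, ht2⟩, hx⟩
    rw [mem_closedBall, dist_zero_right] at hx
    show ((t, x) : ℝ × E³) ∈ parabolicCylinder 1 (0 : ℝ × E³)
    rw [mem_parabolicCylinder]
    simp only [Prod.fst_zero, Prod.snd_zero, dist_zero_right]
    exact ⟨⟨by linarith, by linarith⟩, by linarith⟩
  have hSK : IsCompact (S ∩ Kbig) := by
    have e : S ∩ Kbig = Kbig ∩ {w : ℝ × E³ | IsRegularPoint u w}ᶜ := by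
      ext w
      simp only [hS, mem_inter_iff, mem_singularSet, mem_compl_iff, mem_setOf_eq]
      exact ⟨fun h => ⟨h.2, h.1.2⟩, fun h => ⟨⟨hKbigO h.1, h.2⟩, h.1⟩⟩
    rw [e]
    exact hKbigc.inter_right hRegOpen.isClosed_compl
  -- a good bottom time `b` and a good lateral radius `c`
  have hnull1 : volume (Prod.fst '' (S ∩ Kbig)) = 0 :=
    volume_image_eq_zero_of_isParabolicNull (hSnull.mono inter_subset_left)
      fun z w r hr hr1 hw => abs_fst_sub_fst_le hr hr1 hw
  have hnull2 : volume ((fun w : ℝ × E³ => ‖w.2‖) '' (S ∩ Kbig)) = 0 :=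
    volume_image_eq_zero_of_isParabolicNull (hSnull.mono inter_subset_left)
      fun z w r _ _ hw => abs_norm_snd_sub_le hw
  obtain ⟨b, hb, hbN⟩ := exists_mem_Ioo_not_mem hnull1 (show (-1 / 2 : ℝ) < -1 / 4 by norm_num)
  obtain ⟨c, hc, hcN⟩ := exists_mem_Ioo_not_mem hnull2 (show (1 / 2 : ℝ) < 3 / 4 by norm_num)
  -- the box `F = S ∩ (Icc b ts ×ˢ closedBall 0 c)`, compact and nonempty
  set F : Set (ℝ × E³) := S ∩ (Icc b ws.1 ×ˢ closedBall (0 : E³) c) with hF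
  have hboxK : Icc b ws.1 ×ˢ closedBall (0 : E³) c ⊆ Kbig :=
    prod_mono (Icc_subset_Icc hb.1.le le_rfl) (closedBall_subset_closedBall hc.2.le)
  have hFc : IsCompact F := by
    have e : F = (S ∩ Kbig) ∩ (Icc b ws.1 ×ˢ closedBall (0 : E³) c) := by
      rw [hF, inter_assoc, inter_eq_right.2 hboxK]
    rw [e]
    exact hSK.inter_right (isClosed_Icc.prod isClosed_closedBall)
  have hwsO : ws ∈ (O : Set (ℝ × E³)) := hKbigO ⟨⟨by linarith, le_rfl⟩, by
    rw [mem_closedBall, dist_zero_right]; linarith⟩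
  have hwsF : ws ∈ F := ⟨⟨hwsO, hwsS⟩, ⟨by linarith [hb.2], le_rfl⟩, by
    rw [mem_closedBall, dist_zero_right]; linarith [hc.1]⟩
  -- a singular point of minimal time in the box
  obtain ⟨z₀, hz₀F, hmin⟩ := hFc.exists_isMinOn ⟨ws, hwsF⟩ continuous_fst.continuousOn
  obtain ⟨⟨hz₀O, hz₀S⟩, ⟨hz₀t1, hz₀t2⟩, hz₀x⟩ := hz₀F
  rw [mem_closedBall, dist_zero_right] at hz₀x
  have hz₀K : z₀ ∈ S ∩ Kbig := ⟨⟨hz₀O, hz₀S⟩, hboxK ⟨⟨hz₀t1, hz₀t2⟩, by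
    rw [mem_closedBall, dist_zero_right]; exact hz₀x⟩⟩
  -- the edges are avoided
  have hbt : b < z₀.1 := by
    refine lt_of_le_of_ne hz₀t1 fun h => hbN ⟨z₀, hz₀K, h.symm⟩
  have hxc : ‖z₀.2‖ < c := by
    refine lt_of_le_of_ne hz₀x fun h => hcN ⟨z₀, hz₀K, h⟩
  -- the radius
  set η : ℝ := min (Real.sqrt (z₀.1 - b)) (c - ‖z₀.2‖) with hη
  have hη0 : 0 < η := lt_min (Real.sqrt_pos.2 (by linarith)) (by linarith)
  have hη1 : η ^ 2 ≤ z₀.1 - b := by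
    have h1 : η ≤ Real.sqrt (z₀.1 - b) := min_le_left _ _
    calc η ^ 2 ≤ Real.sqrt (z₀.1 - b) ^ 2 := pow_le_pow_left₀ hη0.le h1 2
      _ = z₀.1 - b := Real.sq_sqrt (by linarith)
  have hη2 : η ≤ c - ‖z₀.2‖ := min_le_right _ _
  -- `Q(z₀, η)` lies in the box below `t₀`, inside `O`
  have hQbox : ∀ w ∈ parabolicCylinder η z₀, w ∈ Kbig ∧ w.1 < z₀.1 ∧
      w ∈ Icc b ws.1 ×ˢ closedBall (0 : E³) c := by
    intro w hw
    rw [mem_parabolicCylinder] at hw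
    obtain ⟨⟨hw1, hw2⟩, hw3⟩ := hw
    have hwx : ‖w.2‖ ≤ c := by
      have h := norm_le_of_mem_closedBall (mem_closedBall.2 hw3.le)
      have : ‖w.2‖ ≤ ‖w.2 - z₀.2‖ + ‖z₀.2‖ := norm_le_norm_sub_add w.2 z₀.2
      rw [← dist_eq_norm] at this
      linarith
    have hwb : b ≤ w.1 := by linarith
    have hbox : w ∈ Icc b ws.1 ×ˢ closedBall (0 : E³) c :=
      ⟨⟨hwb, by linarith⟩, by rw [mem_closedBall, dist_zero_right]; exact hwx⟩
    exact ⟨hboxK hbox, hw2, hbox⟩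
  refine ⟨z₀, η, hη0, fun w hw => hKbigO (hQbox w hw).1, fun w hw => ?_,
    isBackwardSingularPoint_of_not_isRegularPoint hsw hz₀O hz₀S⟩
  -- every point of `Q(z₀, η)` is regular, by minimality of `t₀`
  by_contra hreg
  obtain ⟨hwK, hwt, hwbox⟩ := hQbox w hw
  have hwF : w ∈ F := ⟨⟨hKbigO hwK, hreg⟩, hwbox⟩
  exact absurd (hmin hwF) (not_le.2 hwt)

/-! ### A continuous representative on the regular cylinder -/

/-- **A continuous representative on an open set of regular points** (Caffarelli–Kohn–Nirenberg
1982, §6; Seregin–Šverák 2009, §2 p. 8: "the velocity field `v` is Hölder continuous at regular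
points"): glued from the tree's local representatives
`exists_box_continuousOn_ae_eq_of_isRegularPoint`. -/
theorem exists_continuousOn_representative {O : Opens (ℝ × E³)} {u : ℝ → E³ → E³}
    {p : ℝ → E³ → ℝ} (hsw : IsSuitableWeakSolutionOn O 1 0 u p) {U : Set (ℝ × E³)}
    (hUO : U ⊆ (O : Set (ℝ × E³))) (hU : IsOpen U) (hreg : ∀ w ∈ U, IsRegularPoint u w) :
    ∃ v : ℝ × E³ → E³, ContinuousOn v U ∧ uncurry u =ᵐ[volume.restrict U] v := by
  refine exists_continuousOn_ae_eq_of_locally fun w hw => ?_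
  obtain ⟨δ, hδ, R, hR, -, v, hvc, hve⟩ := exists_box_continuousOn_ae_eq_of_isRegularPoint
    one_pos hsw.distributional hsw.pressure (t₀ := w.1) (x := w.2) (hUO hw) (hreg w hw)
  refine ⟨(Ioo (w.1 - δ) (w.1 + δ) ×ˢ ball w.2 R) ∩ U, (isOpen_Ioo.prod isOpen_ball).inter hU,
    ⟨⟨⟨by linarith, by linarith⟩, mem_ball_self hR⟩, hw⟩, inter_subset_right, v,
    hvc.mono inter_subset_left, ?_⟩
  exact ae_restrict_of_ae_restrict_of_subset inter_subset_left hve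

/-- **The clean vertex with its continuous representative.**  Packaging of
`exists_clean_vertex` and `exists_continuousOn_representative`: a backward singular point `z₀`,
a radius `η > 0` with `Q(z₀, η) ⊆ Q(0, 1)`, and a field `v` continuous on `Q(z₀, η)`, equal to
`u` almost everywhere there, and unbounded near the vertex: `‖v‖` exceeds every bound on every
`Q(z₀, ρ) ∩ Q(z₀, η)`. -/
theorem exists_clean_vertex_representative {u : ℝ → E³ → E³} {p : ℝ → E³ → ℝ}
    (hsw : IsSuitableWeakSolutionOn (parabolicCylinderOpens 1 (0 : ℝ × E³)) 1 0 u p)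
    (hsing : IsBackwardSingularPoint u 0) :
    ∃ (z₀ : ℝ × E³) (η : ℝ) (v : ℝ × E³ → E³), 0 < η ∧
      parabolicCylinder η z₀ ⊆ parabolicCylinder 1 (0 : ℝ × E³) ∧
      (∀ w ∈ parabolicCylinder η z₀, IsRegularPoint u w) ∧
      ContinuousOn v (parabolicCylinder η z₀) ∧
      uncurry u =ᵐ[volume.restrict (parabolicCylinder η z₀)] v ∧
      ∀ ρ : ℝ, 0 < ρ → ∀ M : ℝ, ∃ w ∈ parabolicCylinder (min ρ η) z₀, M < ‖v w‖ := by
  obtain ⟨z₀, η, hη, hsub, hreg, hbs⟩ := exists_clean_vertex hsw hsing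
  obtain ⟨v, hvc, hve⟩ := exists_continuousOn_representative hsw hsub
    (isOpen_parabolicCylinder η z₀) hreg
  refine ⟨z₀, η, v, hη, hsub, hreg, hvc, hve, fun ρ hρ M => ?_⟩
  by_contra h
  push Not at h
  have hρη : 0 < min ρ η := lt_min hρ hη
  have hsub' : parabolicCylinder (min ρ η) z₀ ⊆ parabolicCylinder η z₀ :=
    parabolicCylinder_mono_radius hρη.le (min_le_right _ _) z₀
  -- `‖u‖ ≤ M` a.e. on `Q(z₀, min ρ η)`, contradicting the backward singularity
  have hae : ∀ᵐ w ∂(volume.restrict (parabolicCylinder (min ρ η) z₀)), ‖uncurry u w‖ ≤ M := by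
    have h1 : ∀ᵐ w ∂(volume.restrict (parabolicCylinder (min ρ η) z₀)), uncurry u w = v w :=
      ae_restrict_of_ae_restrict_of_subset hsub' hve
    filter_upwards [h1, ae_restrict_mem (isOpen_parabolicCylinder _ _).measurableSet] with w hw hw'
    rw [hw]
    exact h w hw'
  have hlt : eLpNorm (uncurry u) ⊤ (volume.restrict (parabolicCylinder (min ρ η) z₀)) < ⊤ := by
    refine lt_of_le_of_lt (eLpNorm_le_of_ae_bound (C := M) hae) ?_
    simp
  exact hlt.ne (hbs (min ρ η) hρη)

end Summit.NavierStokesRegularity.NavierStokesRegularity.Theorems.HardyPointSinkABForwardHardy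

end
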